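import Summits.ValiantsHypothesis.ValiantsHypothesis.Theorems.LacunarySymmetroidMatrixDescartesFiniteSectorIterMasks

/-!
# `MatrixDescartes` — line «finite»: the WALKER shape of the finite cores (raw `Nat.rec` enumeration, lagged raw-recursor masks), generic in `m`

HONEST FRAMING.  Object-search cell `pub-symmetroid`, seat val-sym-door-p5 g11.  HELPER of the crux item `stmt-ValiantsHypothesis-18050`
(`Theses.LacunarySymmetroid.MatrixDescartes`) with NO closure claim and no statement about pencils: bit / Bool bookkeeping for the second kernel shape
of the finite cores of line «finite» (successor of `…FiniteSectorIterMasks`, p692255).  The pruned enumeration of sorted value lists is ONE Bool term: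
each level is the raw-recursor WALKER `Nat.rec (fun _ => true) (fun _ ih c => cond (guard c) (body c && ih (c+1)) true) fuel start` (candidates upward
from `start`, stop at the first guard failure — the children of a prefix form an interval), the `j`-fold sum mask of a prefix `l` is the LAGGED raw iterate
`Nat.rec (F l 1) (fun _ acc => F l acc) (j-1)` of the shift-or step `F l` (so that the kernel's iota chain caches exactly the masks the last level asks
for), the last value's mask is incremental, and bit / cover / alive tests are spelled with `Nat.beq` / `Nat.mod` / `Nat.div` / `Nat.pow` (GMP-backed; closed threshold powers stay `2 ^ t`,
no instance unfolding).  Lemmas: `walk_true` (walker soundness), `lagMask_eq_iterate`, membership ⇒ bit for the lagged and incremental masks, the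
raw bit / cover / alive bridges, and the guard facts along an interval.  Nothing here bears on the crux, the doors, or `VP ≠ VNP`.
[folklore] Elementary bit arithmetic; no citation is load-bearing.
-/

-- `Summit.ValiantsHypothesis.ValiantsHypothesis.…` repeats a component by the D-0017 layout
-- (single-conjunct summit), which the `dupNamespace` linter flags; the name is mandated.
set_option linter.dupNamespace false

namespace Summit.ValiantsHypothesis.ValiantsHypothesis.Theorems.LacunarySymmetroidMatrixDescartes.FiniteSector

/-! ## The walker -/

/-- **Walker soundness.**  If the walker from `s` with fuel `n` returns `true`, `s ≤ c < s + n`, and the guard `p` holds on `[s, c]`, then the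
body `q` holds at `c`. [folklore] -/
theorem walk_true {p q : ℕ → Bool} : ∀ (n s c : ℕ), s ≤ c → c < s + n → (∀ c', s ≤ c' → c' ≤ c → p c' = true) →
    @Nat.rec (fun _ => ℕ → Bool) (fun _ => true)
      (fun (_ : ℕ) (ih : ℕ → Bool) (c : ℕ) => cond (p c) (q c && ih (c + 1)) true) n s = true → q c = true := by
  intro n
  induction n with
  | zero => intro s c hs hc; omega
  | succ n ih =>
    intro s c hs hc hp h
    have h' : cond (p s) (q s && @Nat.rec (fun _ => ℕ → Bool) (fun _ => true)
        (fun (_ : ℕ) (ih : ℕ → Bool) (c : ℕ) => cond (p c) (q c && ih (c + 1)) true) n (s + 1)) true = true := h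
    rw [hp s le_rfl hs, cond_true, Bool.and_eq_true] at h'
    rcases Nat.eq_or_lt_of_le hs with rfl | hlt
    · exact h'.1
    · exact ih (s + 1) c hlt (by omega) (fun c' h1 h2 => hp c' (by omega) h2) h'.2

/-! ## Lagged raw-recursor masks -/

/-- The lagged raw iterate `Nat.rec (F l 1) (fun _ acc => F l acc) j` is the `(j+1)`-st iterate `(F l)^[j+1] 1`. [folklore] -/
theorem lagMask_eq_iterate (l : List ℕ) (j : ℕ) :
    @Nat.rec (fun _ => ℕ)
      ((fun (E : ℕ) => @List.rec ℕ (fun _ => ℕ) 0 (fun (x : ℕ) (_ : List ℕ) (acc : ℕ) => Nat.lor acc (Nat.shiftLeft E x)) l) 1)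
      (fun (_ acc : ℕ) => (fun (E : ℕ) => @List.rec ℕ (fun _ => ℕ) 0 (fun (x : ℕ) (_ : List ℕ) (acc : ℕ) => Nat.lor acc (Nat.shiftLeft E x)) l) acc) j =
    ((fun (E : ℕ) => @List.rec ℕ (fun _ => ℕ) 0 (fun (x : ℕ) (_ : List ℕ) (acc : ℕ) => Nat.lor acc (Nat.shiftLeft E x)) l)^[j + 1] 1) := by
  induction j with
  | zero => rfl
  | succ j ih =>
    rw [Function.iterate_succ_apply', ← ih]

/-- **Membership ⇒ bit, lagged form**: `t` over `l` with `card t = j + 1` ⇒ bit `t.sum` of the lagged `(j+1)`-fold mask. [folklore] -/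
theorem testBit_lagMask_of_multiset (l : List ℕ) (j : ℕ) (t : Multiset ℕ) (ht : ∀ x ∈ t, x ∈ l)
    (hm : Multiset.card t = j + 1) :
    (@Nat.rec (fun _ => ℕ)
      ((fun (E : ℕ) => @List.rec ℕ (fun _ => ℕ) 0 (fun (x : ℕ) (_ : List ℕ) (acc : ℕ) => Nat.lor acc (Nat.shiftLeft E x)) l) 1)
      (fun (_ acc : ℕ) => (fun (E : ℕ) => @List.rec ℕ (fun _ => ℕ) 0 (fun (x : ℕ) (_ : List ℕ) (acc : ℕ) => Nat.lor acc (Nat.shiftLeft E x)) l) acc)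
      j).testBit t.sum = true := by
  rw [lagMask_eq_iterate]
  exact testBit_iterMask_of_multiset' l (j + 1) t ht hm

/-- Bit `0` of every lagged mask of a list containing `0` is set (`0 = 0 + ⋯ + 0`). [folklore] -/
theorem testBit_lagMask_zero (l : List ℕ) (j : ℕ) (h0 : 0 ∈ l) :
    (@Nat.rec (fun _ => ℕ)
      ((fun (E : ℕ) => @List.rec ℕ (fun _ => ℕ) 0 (fun (x : ℕ) (_ : List ℕ) (acc : ℕ) => Nat.lor acc (Nat.shiftLeft E x)) l) 1)
      (fun (_ acc : ℕ) => (fun (E : ℕ) => @List.rec ℕ (fun _ => ℕ) 0 (fun (x : ℕ) (_ : List ℕ) (acc : ℕ) => Nat.lor acc (Nat.shiftLeft E x)) l) acc)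
      j).testBit 0 = true := by
  have h := testBit_lagMask_of_multiset l j (Multiset.replicate (j + 1) 0)
    (fun x hx => (Multiset.eq_of_mem_replicate hx).symm ▸ h0) (Multiset.card_replicate _ _)
  simpa using h

/-- **Membership ⇒ bit, incremental form over lagged masks**: `t` over `l ++ [c]`, `card t = m` ⇒ bit `t.sum` of
`Nat.rec 1 (fun k acc => LAG l k ||| (acc <<< c)) m`. [folklore] -/
theorem testBit_incMask2_of_multiset (l : List ℕ) (c m : ℕ) (t : Multiset ℕ) (ht : ∀ x ∈ t, x ∈ l ++ [c])
    (hm : Multiset.card t = m) :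
    (@Nat.rec (fun _ => ℕ) 1 (fun (k acc : ℕ) => Nat.lor
      (@Nat.rec (fun _ => ℕ)
        ((fun (E : ℕ) => @List.rec ℕ (fun _ => ℕ) 0 (fun (x : ℕ) (_ : List ℕ) (acc : ℕ) => Nat.lor acc (Nat.shiftLeft E x)) l) 1)
        (fun (_ acc : ℕ) => (fun (E : ℕ) => @List.rec ℕ (fun _ => ℕ) 0 (fun (x : ℕ) (_ : List ℕ) (acc : ℕ) => Nat.lor acc (Nat.shiftLeft E x)) l) acc)
        k)
      (Nat.shiftLeft acc c)) m).testBit t.sum = true := by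
  have hfun : (fun (k acc : ℕ) => Nat.lor
      (@Nat.rec (fun _ => ℕ)
        ((fun (E : ℕ) => @List.rec ℕ (fun _ => ℕ) 0 (fun (x : ℕ) (_ : List ℕ) (acc : ℕ) => Nat.lor acc (Nat.shiftLeft E x)) l) 1)
        (fun (_ acc : ℕ) => (fun (E : ℕ) => @List.rec ℕ (fun _ => ℕ) 0 (fun (x : ℕ) (_ : List ℕ) (acc : ℕ) => Nat.lor acc (Nat.shiftLeft E x)) l) acc)
        k)
      (Nat.shiftLeft acc c)) =
      (fun (k acc : ℕ) => Nat.lor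
        (((fun (E : ℕ) => @List.rec ℕ (fun _ => ℕ) 0 (fun (x : ℕ) (_ : List ℕ) (acc : ℕ) => Nat.lor acc (Nat.shiftLeft E x)) l)^[k + 1] 1))
        (Nat.shiftLeft acc c)) := by
    funext k acc
    rw [lagMask_eq_iterate]
  rw [hfun]
  exact testBit_incMask_of_multiset l c m t ht hm

/-! ## Raw bit / cover / alive tests -/

/-- The raw bit test `(M / 2^i) % 2 == 1` is `M.testBit i`. [folklore] -/
theorem rawBit_eq_true_iff (M i : ℕ) : Nat.beq (Nat.mod (Nat.div M (Nat.pow 2 i)) 2) 1 = true ↔ M.testBit i = true := by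
  rw [Nat.beq_eq, Nat.testBit_eq_decide_div_mod_eq, decide_eq_true_iff]
  exact Iff.rfl

/-- The raw bit test at a `^`-spelled index. [folklore] -/
theorem rawBit_eq_true_iff' (M i : ℕ) : Nat.beq (Nat.mod (Nat.div M (2 ^ i)) 2) 1 = true ↔ M.testBit i = true :=
  rawBit_eq_true_iff M i

/-- Raw cover test from bits: all bits below `t` set ⇒ `M % 2^t == 2^t - 1`. [folklore] -/
theorem rawCover_of_testBit {M t : ℕ} (h : ∀ r < t, M.testBit r = true) :
    Nat.beq (Nat.mod M (2 ^ t)) (2 ^ t - 1) = true := by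
  rw [Nat.beq_eq]
  exact maskFull_of_testBit h

/-- Raw alive test from bits: for every `r < t` bit `r` or `r+1` set ⇒ `(M ||| M/2) % 2^t == 2^t - 1`. [folklore] -/
theorem rawAlive_of_testBit {M t : ℕ} (h : ∀ r < t, M.testBit r = true ∨ M.testBit (r + 1) = true) :
    Nat.beq (Nat.mod (Nat.lor M (Nat.div M 2)) (2 ^ t)) (2 ^ t - 1) = true := by
  rw [Nat.beq_eq]
  exact maskAlive_of_testBit h

/-! ## Guard facts along an interval -/

/-- **Cover guards.**  If `Mp` covers `[0, min T c)`, `c < C ≤ T + 1`, then the raw bit `c' - 1` of `Mp` is set for every `c' ∈ [lo+1, c]`. [folklore] -/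
theorem cover_guards {Mp lo c C T : ℕ} (hcC : c < C) (hCT : C ≤ T + 1)
    (hcov : ∀ r < min T c, Mp.testBit r = true) :
    ∀ c', lo + 1 ≤ c' → c' ≤ c → Nat.beq (Nat.mod (Nat.div Mp (Nat.pow 2 (c' - 1))) 2) 1 = true := by
  intro c' h1 h2
  rw [rawBit_eq_true_iff]
  have : c' - 1 < c := by omega
  have : c' - 1 < T := by omega
  exact hcov (c' - 1) (lt_min ‹_› ‹c' - 1 < c›)

/-- **Alive guards.**  If bit `0` of `Mp` is set and the step-≤-2 chain of `Mp` is alive below `min T (c - 1)`, then for every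
`c' ∈ [lo+1, c]`: `T + 2 ≤ c'` or the raw bit `c' - 2` of `Mp ||| Mp/2` is set. [folklore] -/
theorem alive_guards {Mp lo c T : ℕ} (h0 : Mp.testBit 0 = true)
    (halive : ∀ r < min T (c - 1), Mp.testBit r = true ∨ Mp.testBit (r + 1) = true) :
    ∀ c', lo + 1 ≤ c' → c' ≤ c →
      (Nat.ble (T + 2) c' || Nat.beq (Nat.mod (Nat.div (Nat.lor Mp (Nat.div Mp 2)) (Nat.pow 2 (c' - 2))) 2) 1) = true := by
  intro c' h1 h2
  rw [Bool.or_eq_true_iff]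
  by_cases hT : T + 2 ≤ c'
  · exact Or.inl (Nat.ble_eq_true_of_le hT)
  · right
    rw [rawBit_eq_true_iff]
    have e1 : ∀ a b : ℕ, Nat.lor a b = a ||| b := fun _ _ => rfl
    have e2 : ∀ a : ℕ, Nat.div a 2 = a / 2 := fun _ => rfl
    rw [e1, e2, Nat.testBit_lor, Bool.or_eq_true_iff, ← Nat.testBit_succ]
    by_cases hc' : c' ≤ 2
    · have : c' - 2 = 0 := by omega
      rw [this]
      exact Or.inl h0
    · have : c' - 2 < c - 1 := by omega
      have : c' - 2 < T := by omega
      exact halive (c' - 2) (lt_min ‹_› ‹c' - 2 < c - 1›)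

end Summit.ValiantsHypothesis.ValiantsHypothesis.Theorems.LacunarySymmetroidMatrixDescartes.FiniteSector
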